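import Literature.Probability.Percolation.TriBoundaryWinding
import Literature.Probability.RandomPlanarGeometry.JordanIndexLift
import Literature.Probability.RandomPlanarGeometry.PlanarDomainsTopology
import Literature.Topology.PlaneTopology.JordanCurveProofs
import Literature.Topology.PlaneTopology.AnnulusArcs
import HarnessLib

/-!
# The tips of the tethers advance anticlockwise along the boundary

Topic `Literature/Probability/Percolation`; family `crit-perc`. The orientation input of the
construction of the marked discrete approximations `G_δ⁻` in Bollobás–Riordan, *Percolation*
(2006), Ch. 7 Lemma 14 (p. 184) and p. 191 ("Let us trace the boundary of `G_δ⁻` anticlockwise"):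
for a disc `G = tileUnion S₀` deep inside a Jordan domain `D` whose boundary loop is anticlockwise
(`D.index = 1` on `D`), with tethers at every boundary dart, if three positions
`n₁ < n₁ + k₂ < n₁ + k₃ < n₁ + #∂G` of the (anticlockwise, `bdryTail`) boundary traversal have tips
`qₖ = ∂D(σₖ)` (`k = 1, 3`, `|σ₁ - σ₃| < 1`) and pairwise far tails, and some point of `∂D` has a
neighbourhood meeting a face of `G` but missing the direct arc `∂D([σ₁, σ₃])`, the two tethers and
the tail polyline from `n₁` to `n₁ + k₃`, then `σ₁ < σ₃` (**`tips_advance`**): along the traversal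
the boundary parameters of the tips increase.

Proof (winding numbers, continuing `no_interleaving`, `TriBoundaryWinding.lean`): for a path `β` on
`∂D` from `q₃` to `q₁` let `J_β` be the loop (tail polyline) · (tether at `n₁ + k₃`) · `β` ·
(tether at `n₁`)⁻¹. For every such `β`, `J_β` crosses the centre segment `[ℓ, r]` of the exit edge
of the run of the tail `u₂ = t(n₁ + k₂)` once (`wind ℓ - wind r = 1`), and `r` is joined off `J_β`
to the tip `q₂` (fans at `u₂`, tether at `n₁ + k₂`); if `q₂ ∉ β`, then on through the exterior of
`D` (Jordan curve theorem, `JordanDomain.exterior_of_JCT`) to far away, so `wind r = 0`. For the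
direct arc `α` the far neighbourhood joins `ℓ` to the exterior, so `wind ℓ = 0`, `wind r = -1`,
whence `q₂ ∈ α`, so `q₂` is off the complementary arc `α'` and `wind_{J_α'} r = 0`; finally
`wind_{J_α} r - wind_{J_α'} r = ± D.index r = ±1` with the sign of the loop `α · α'⁻¹`
(`wind_boundary_comp_eq_mul_index`), which forces `α` to run backwards: `σ₁ < σ₃`.

## References

* B. Bollobás, O. Riordan, *Percolation*, Cambridge University Press (2006), Ch. 7 Lemma 14 p. 184,
  §7.2.5 p. 191; §7.2.2 p. 169 (anticlockwise traversal of `∂⁻G`).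

## Mathlib / tree

Mathlib: `Path.trans`, `Continuous.if_le`, `Metric.mem_closure_iff`. Tree: `TriBoundaryWinding.lean`
(`run_window`, `tailStep_not_mem_fanSeg`, `midpoint_mem_fanSeg`, `AvoidsMeshOf.not_mem_tailStep`,
`meshCenter_mem_connectedComponentIn_of_pathIn`, `not_mem_centreSeg_of_mem_tailStep`),
`ArgumentIncrement.lean` (`Path.crossInc_*`, `Path.argInc_trans`, `Path.argInc_symm`,
`Path.argInc_eq_wind_mul`, `wind_sub_eq_of_mem_connectedComponentIn`), `AnnulusArcs.lean`
(`wind_sub_eq_zero_of_dist_le`), `JordanIndexLift.lean` (`wind_boundary_comp_eq_mul_index`),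
`PlanarDomainsTopology.lean` (`exterior_of_JCT`, `frontier_subset_closure_exterior`),
`JordanCurveProofs.lean` (`JordanCurveTheorem_holds`).
-/

noncomputable section

open Set Metric Complex Filter Topology Literature.Topology.PlaneTopology Literature.Probability.LatticeModels
  Literature.Probability.RandomPlanarGeometry

namespace Literature.Probability.Percolation

open RemovableAt (hexFaceVertices_leftFaceDir exists_offset)

/-- Parameter bookkeeping for the direct and the complementary arc between `∂D(σ₃)` and `∂D(σ₁)`
(`|σ₁ - σ₃| < 1`): a common point of both arcs is an endpoint. [folklore] -/
theorem eq_endpoint_of_mem_both {σ₁ σ₃ s s' : ℝ} (h13 : |σ₁ - σ₃| < 1) (hs0 : 0 ≤ s) (hs1 : s ≤ 1) (hs0' : 0 ≤ s') (hs1' : s' ≤ 1)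
    {n : ℤ} (hn : σ₃ + s' * ((σ₁ - ((if σ₁ ≤ σ₃ then -1 else 1 : ℤ) : ℝ)) - σ₃) = σ₃ + s * (σ₁ - σ₃) + n) :
    σ₃ + s * (σ₁ - σ₃) = σ₃ ∨ σ₃ + s * (σ₁ - σ₃) = σ₁ := by
  obtain ⟨h1, h2⟩ := abs_lt.1 h13
  by_cases hle : σ₁ ≤ σ₃
  · rw [if_pos hle] at hn
    push_cast at hn
    have hy1 : σ₁ ≤ σ₃ + s * (σ₁ - σ₃) := by nlinarith
    have hy2 : σ₃ + s * (σ₁ - σ₃) ≤ σ₃ := by nlinarith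
    have hy1' : σ₃ ≤ σ₃ + s' * (σ₁ - (-1) - σ₃) := by nlinarith
    have hy2' : σ₃ + s' * (σ₁ - (-1) - σ₃) ≤ σ₁ + 1 := by nlinarith
    have hn0 : (0 : ℝ) ≤ n := by linarith
    have hn1 : (n : ℝ) ≤ 1 := by linarith
    have hn01 : n = 0 ∨ n = 1 := by
      have h0' : 0 ≤ n := by exact_mod_cast hn0
      have h1' : n ≤ 1 := by exact_mod_cast hn1
      omega
    rcases hn01 with rfl | rfl
    · left; push_cast at hn; linarith
    · right; push_cast at hn; linarith
  · rw [if_neg hle] at hn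
    push_cast at hn
    push Not at hle
    have hy1 : σ₃ ≤ σ₃ + s * (σ₁ - σ₃) := by nlinarith
    have hy2 : σ₃ + s * (σ₁ - σ₃) ≤ σ₁ := by nlinarith
    have hy1' : σ₁ - 1 ≤ σ₃ + s' * (σ₁ - 1 - σ₃) := by nlinarith
    have hy2' : σ₃ + s' * (σ₁ - 1 - σ₃) ≤ σ₃ := by nlinarith
    have hn0 : (n : ℝ) ≤ 0 := by linarith
    have hn1 : (-1 : ℝ) ≤ n := by linarith
    have hn01 : n = 0 ∨ n = -1 := by
      have h0' : n ≤ 0 := by exact_mod_cast hn0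
      have h1' : -1 ≤ n := by exact_mod_cast hn1
      omega
    rcases hn01 with rfl | rfl
    · left; push_cast at hn; linarith
    · right; push_cast at hn; linarith

/-- **The tips advance anticlockwise** (see the module docstring). [cite: BollobasRiordan2006, Ch. 7 Lemma 14 p. 184, p. 191] -/
theorem tips_advance {S₀ : Finset (Site 2)} {b : Site 2 × Site 2} (hD : IsTriDisc (tileUnion S₀) b)
    (hconn : ∀ c ∈ S₀, ∀ c' ∈ S₀, PathIn triGraph (↑S₀ : Set (Site 2)) c c')
    (D : JordanDomain) (hind : ∀ z ∈ D.carrier, D.index z = 1) {δ : ℝ} (hδ : 0 < δ)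
    (hGU : ∀ g ∈ tileUnion S₀, closedBall (triMeshPoint δ g) (2 * δ) ⊆ D.carrier)
    (τ : ∀ n : ℕ, Tether D.carrier (tileUnion S₀) δ (bdryTail (tileUnion S₀) b n) (triBdryIter (tileUnion S₀) b n).2)
    {σ₁ σ₃ : ℝ} {n₁ k₂ k₃ : ℕ} (h23 : k₂ < k₃) (h3N : k₃ < (triBdryDarts (tileUnion S₀)).card)
    (hq₁ : D.boundary σ₁ = (τ n₁).tip) (hq₃ : D.boundary σ₃ = (τ (n₁ + k₃)).tip) (h13 : |σ₁ - σ₃| < 1)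
    (d21 : 24 * δ < dist (triMeshPoint δ (bdryTail (tileUnion S₀) b (n₁ + k₂))) (triMeshPoint δ (bdryTail (tileUnion S₀) b n₁)))
    (d23 : 24 * δ < dist (triMeshPoint δ (bdryTail (tileUnion S₀) b (n₁ + k₂))) (triMeshPoint δ (bdryTail (tileUnion S₀) b (n₁ + k₃))))
    {x : ℂ} (hx : x ∈ frontier D.carrier) {ρ : ℝ} (hρ : 0 < ρ)
    (hxF : ∃ F₀ : HexVertex, hexFaceVertices F₀ ⊆ tileUnion S₀ ∧ dist (meshCenter δ F₀) x < ρ)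
    (hxα : ∀ z ∈ ball x ρ, z ∉ D.boundary '' Icc (min σ₁ σ₃) (max σ₁ σ₃))
    (hx1 : ∀ z ∈ ball x ρ, 12 * δ < dist z (triMeshPoint δ (bdryTail (tileUnion S₀) b n₁)))
    (hx3 : ∀ z ∈ ball x ρ, 12 * δ < dist z (triMeshPoint δ (bdryTail (tileUnion S₀) b (n₁ + k₃))))
    (hxκ : ∀ z ∈ ball x ρ, ∀ i < k₃, z ∉ segment ℝ (triMeshPoint δ (bdryTail (tileUnion S₀) b (n₁ + i)))
      (triMeshPoint δ (bdryTail (tileUnion S₀) b (n₁ + i + 1)))) :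
    σ₁ < σ₃ := by
  set N := (triBdryDarts (tileUnion S₀)).card with hN
  have hδ0 := hδ.ne'
  have hJCT := Literature.Topology.PlaneTopology.JordanCurveTheorem_holds
  obtain ⟨hEc, hEfr, hEb⟩ := D.exterior_of_JCT hJCT
  have hrem : ∀ u ∈ tileUnion S₀, (∃ j : Fin 6, u + triDir j ∉ tileUnion S₀) →
      ∃ a m : Fin 6, RemovableAt (tileUnion S₀) u a m ∧ m.val ≤ 4 := fun u hu hout => by
    obtain ⟨a, m, h, hm⟩ := exists_removableAt_of_mem_tileUnion hu hout
    exact ⟨a, m, h, by omega⟩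
  have hremt : ∀ n, ∃ a m : Fin 6, RemovableAt (tileUnion S₀) (bdryTail (tileUnion S₀) b n) a m ∧ m.val ≤ 3 := fun n => by
    obtain ⟨hx, hy, hadj⟩ := mem_triBdryDarts.1 (triBdryIter_mem hD.base_mem n)
    obtain ⟨j, hj⟩ := (triGraph_adj_iff_triDir _ _).1 hadj
    exact exists_removableAt_of_mem_tileUnion hx ⟨j, hj ▸ hy⟩
  have hhead : ∀ n, ∃ t₀ : Fin 6, (triBdryIter (tileUnion S₀) b n).2 = bdryTail (tileUnion S₀) b n + triDir t₀ ∧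
      bdryTail (tileUnion S₀) b n + triDir t₀ ∉ tileUnion S₀ := fun n => by
    obtain ⟨-, hy, hadj⟩ := mem_triBdryDarts.1 (triBdryIter_mem hD.base_mem n)
    obtain ⟨j, hj⟩ := (triGraph_adj_iff_triDir _ _).1 hadj
    exact ⟨j, hj, hj ▸ hy⟩
  have htip : ∀ n, dist (τ n).tip (triMeshPoint δ (bdryTail (tileUnion S₀) b n)) ≤ 12 * δ := fun n => by
    have := (τ n).dist_le 1; rwa [(τ n).path.target] at this
  have hne21 : bdryTail (tileUnion S₀) b (n₁ + k₂) ≠ bdryTail (tileUnion S₀) b n₁ := fun h => by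
    rw [h, dist_self] at d21; linarith
  have hne23 : bdryTail (tileUnion S₀) b (n₁ + k₂) ≠ bdryTail (tileUnion S₀) b (n₁ + k₃) := fun h => by
    rw [h, dist_self] at d23; linarith
  have hq21 : (τ (n₁ + k₂)).tip ≠ (τ n₁).tip := fun h => by
    have h1 := htip (n₁ + k₂); have h2 := htip n₁
    rw [h] at h1
    have := dist_triangle_left (triMeshPoint δ (bdryTail (tileUnion S₀) b (n₁ + k₂))) (triMeshPoint δ (bdryTail (tileUnion S₀) b n₁)) (τ n₁).tip
    linarith
  have hq23 : (τ (n₁ + k₂)).tip ≠ (τ (n₁ + k₃)).tip := fun h => by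
    have h1 := htip (n₁ + k₂); have h2 := htip (n₁ + k₃)
    rw [h] at h1
    have := dist_triangle_left (triMeshPoint δ (bdryTail (tileUnion S₀) b (n₁ + k₂))) (triMeshPoint δ (bdryTail (tileUnion S₀) b (n₁ + k₃))) (τ (n₁ + k₃)).tip
    linarith
  have hu₁G : bdryTail (tileUnion S₀) b n₁ ∈ tileUnion S₀ := bdryTail_mem hD _
  have hu₂G : bdryTail (tileUnion S₀) b (n₁ + k₂) ∈ tileUnion S₀ := bdryTail_mem hD _
  ---------------------------------------------------------------------------------------------
  -- the run of `u₂` and its exit edge, `ℓ`, `r`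
  ---------------------------------------------------------------------------------------------
  obtain ⟨a₂, m₂, hR₂, hm₂⟩ := hremt (n₁ + k₂)
  obtain ⟨d₂, hd₂, hrun₂, hexit₂⟩ := run_window hD hR₂ (rfl : bdryTail (tileUnion S₀) b (n₁ + k₂) = bdryTail (tileUnion S₀) b (n₁ + k₂))
  have hi₀ : k₂ + d₂ < k₃ := by
    by_contra h
    have := hrun₂ (k₃ - k₂) (by omega)
    rw [show n₁ + k₂ + (k₃ - k₂) = n₁ + k₃ by omega] at this
    exact hne23 this.symm
  set i₀ := k₂ + d₂ with hi₀def
  have ht_i₀ : bdryTail (tileUnion S₀) b (n₁ + i₀) = bdryTail (tileUnion S₀) b (n₁ + k₂) := by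
    rw [hi₀def, ← add_assoc]; exact hrun₂ d₂ le_rfl
  have ht_i₀' : bdryTail (tileUnion S₀) b (n₁ + i₀ + 1) = bdryTail (tileUnion S₀) b (n₁ + k₂) + triDir (a₂ + m₂) := by
    rw [hi₀def, ← add_assoc]; exact hexit₂
  set K₂ := a₂ + m₂ with hK₂
  set g₂ := bdryTail (tileUnion S₀) b (n₁ + k₂) + triDir K₂ with hg₂
  have hg₂ne : bdryTail (tileUnion S₀) b (n₁ + k₂) ≠ g₂ := fun h =>
    triDir_ne_zero K₂ (by rw [hg₂] at h; exact (add_eq_left.1 h.symm))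
  set Fe := leftFaceDir (bdryTail (tileUnion S₀) b (n₁ + k₂)) K₂ with hFe
  set j₂ := jExit K₂ with hj₂
  set ℓ := meshCenter δ Fe with hℓ
  set r := meshCenter δ (oppFace Fe j₂) with hr
  have hFopp : oppFace Fe j₂ = leftFaceDir (bdryTail (tileUnion S₀) b (n₁ + k₂)) (K₂ + 5) := oppFace_leftFaceDir_jExit _ K₂
  have hfv1 : faceVertex Fe (j₂ + 1) = bdryTail (tileUnion S₀) b (n₁ + k₂) := faceVertex_leftFaceDir_jExit_succ _ K₂
  have hfv2 : faceVertex Fe (j₂ + 2) = g₂ := faceVertex_leftFaceDir_jExit_succ_succ _ K₂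
  have hg₂G : g₂ ∈ tileUnion S₀ := hR₂.inside le_rfl
  have hFeG : hexFaceVertices Fe ⊆ tileUnion S₀ := by
    rw [hFe, hexFaceVertices_leftFaceDir]
    intro y hy
    simp only [Finset.mem_insert, Finset.mem_singleton] at hy
    rcases hy with rfl | rfl | rfl
    · exact hu₂G
    · exact hg₂G
    · rw [hK₂, add_assoc]
      refine hR₂.inside ?_
      rw [Fin6.val_add_of_lt (by simp; omega)]; simp
  have hℓr_near : ∀ z ∈ segment ℝ ℓ r, dist z (triMeshPoint δ (bdryTail (tileUnion S₀) b (n₁ + k₂))) ≤ δ := fun z hz => by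
    rw [hr, hFopp] at hz
    exact dist_le_of_mem_fanSeg hδ _ K₂ hz
  have hℓr_U : segment ℝ ℓ r ⊆ D.carrier := fun z hz =>
    hGU _ hu₂G (mem_closedBall.2 (by linarith [hℓr_near z hz]))
  have hrU : r ∈ D.carrier := hℓr_U (right_mem_segment _ _ _)
  have hr_fr : r ∉ frontier D.carrier := fun h => by rw [D.isOpen.frontier_eq] at h; exact h.2 hrU
  ---------------------------------------------------------------------------------------------
  -- the fixed pieces of the loops
  ---------------------------------------------------------------------------------------------
  obtain ⟨κ, hκr, hκc, hκa⟩ : ∃ κ : Path (triMeshPoint δ (bdryTail (tileUnion S₀) b n₁)) (triMeshPoint δ (bdryTail (tileUnion S₀) b (n₁ + k₃))),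
      range κ = range (tailPoly δ (tileUnion S₀) b n₁ k₃) ∧
        (∀ p q : ℂ, κ.crossInc p q = (tailPoly δ (tileUnion S₀) b n₁ k₃).crossInc p q) ∧
        (∀ p : ℂ, κ.argInc p = (tailPoly δ (tileUnion S₀) b n₁ k₃).argInc p) :=
    ⟨tailPoly δ (tileUnion S₀) b n₁ k₃, rfl, fun _ _ => rfl, fun _ => rfl⟩
  set τ₁ := (τ n₁).path with hτ₁
  set τ₃ := (τ (n₁ + k₃)).path with hτ₃
  -- criteria for being off the fixed pieces
  have hκ_off' : ∀ z, z ≠ triMeshPoint δ (bdryTail (tileUnion S₀) b n₁) →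
      (∀ i < k₃, z ∉ segment ℝ (triMeshPoint δ (bdryTail (tileUnion S₀) b (n₁ + i))) (triMeshPoint δ (bdryTail (tileUnion S₀) b (n₁ + i + 1)))) →
      z ∉ range κ := fun z h0 hz => by rw [hκr]; exact not_mem_range_tailPoly δ (tileUnion S₀) b h0 hz
  have hκ_off : ∀ z, (∀ n, z ∉ segment ℝ (triMeshPoint δ (bdryTail (tileUnion S₀) b n)) (triMeshPoint δ (bdryTail (tileUnion S₀) b (n + 1)))) →
      z ∉ range κ := fun z hz =>
    hκ_off' z (fun h => hz n₁ (h ▸ left_mem_segment _ _ _)) fun i _ => hz (n₁ + i)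
  have hτ_off : ∀ n z, 12 * δ < dist z (triMeshPoint δ (bdryTail (tileUnion S₀) b n)) → z ∉ range (τ n).path := by
    rintro n z hz ⟨s, rfl⟩
    exact absurd ((τ n).dist_le s) (not_le.2 hz)
  have hnotU_of_frontier : ∀ z ∈ frontier D.carrier, z ∉ D.carrier := fun z hz => by
    rw [D.isOpen.frontier_eq] at hz; exact hz.2
  have near_off : ∀ z, dist z (triMeshPoint δ (bdryTail (tileUnion S₀) b (n₁ + k₂))) ≤ 12 * δ → z ∉ range τ₃ ∧ z ∉ range τ₁ := by
    intro z hz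
    have t3 := dist_triangle (triMeshPoint δ (bdryTail (tileUnion S₀) b (n₁ + k₂))) z (triMeshPoint δ (bdryTail (tileUnion S₀) b (n₁ + k₃)))
    have t1 := dist_triangle (triMeshPoint δ (bdryTail (tileUnion S₀) b (n₁ + k₂))) z (triMeshPoint δ (bdryTail (tileUnion S₀) b n₁))
    have dc := dist_comm z (triMeshPoint δ (bdryTail (tileUnion S₀) b (n₁ + k₂)))
    exact ⟨hτ_off (n₁ + k₃) z (by linarith), hτ_off n₁ z (by linarith)⟩
  have hκU : ∀ n z, z ∈ segment ℝ (triMeshPoint δ (bdryTail (tileUnion S₀) b n)) (triMeshPoint δ (bdryTail (tileUnion S₀) b (n + 1))) →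
      z ∈ D.carrier := by
    intro n z hz
    refine hGU _ (bdryTail_mem hD n) (mem_closedBall.2 ?_)
    refine dist_le_of_mem_segment (by rw [dist_self]; positivity) ?_ hz
    rcases bdryTail_succ_eq_or_adj hD n with h | h
    · rw [h, dist_self]; positivity
    · rw [dist_comm, dist_triMeshPoint_eq_of_adj hδ.le h]; linarith
  have hκU' : range κ ⊆ D.carrier := by
    intro z hz
    by_contra hzU
    exact hκ_off z (fun n hzn => hzU (hκU n z hzn)) hz
  have hτcl : ∀ n, range (τ n).path ⊆ closure D.carrier := by
    rintro n z ⟨s, rfl⟩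
    rcases eq_or_lt_of_le s.2.2 with hs1 | hs1
    · have : (τ n).path s = (τ n).tip := by rw [show s = 1 from Subtype.ext hs1]; exact (τ n).path.target
      rw [this]; exact frontier_subset_closure (τ n).tip_mem
    · exact subset_closure ((τ n).mem_of_lt_one s hs1)
  -- `ℓ`, `r` are off the fixed pieces
  have hℓ_step : ∀ n, ℓ ∉ segment ℝ (triMeshPoint δ (bdryTail (tileUnion S₀) b n)) (triMeshPoint δ (bdryTail (tileUnion S₀) b (n + 1))) :=
    fun n => meshCenter_not_mem_meshEdge hδ0 Fe ((bdryTail_succ_eq_or_adj hD n).imp Eq.symm id)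
  have hr_step : ∀ n, r ∉ segment ℝ (triMeshPoint δ (bdryTail (tileUnion S₀) b n)) (triMeshPoint δ (bdryTail (tileUnion S₀) b (n + 1))) :=
    fun n => meshCenter_oppFace_not_mem_meshEdge hδ0 Fe j₂ ((bdryTail_succ_eq_or_adj hD n).imp Eq.symm id)
  have hℓ_seg : ℓ ∈ segment ℝ ℓ r := left_mem_segment _ _ _
  have hr_seg : r ∈ segment ℝ ℓ r := right_mem_segment _ _ _
  have hoffτ_of_seg : ∀ z ∈ segment ℝ ℓ r, z ∉ range τ₃ ∧ z ∉ range τ₁ := fun z hz => near_off z (by linarith [hℓr_near z hz])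
  have hℓκ := hκ_off ℓ hℓ_step
  have hrκ := hκ_off r hr_step
  have hℓ3 := (hoffτ_of_seg ℓ hℓ_seg).1
  have hℓ1 := (hoffτ_of_seg ℓ hℓ_seg).2
  have hr3 := (hoffτ_of_seg r hr_seg).1
  have hr1 := (hoffτ_of_seg r hr_seg).2
  -- a bound for everything: `closure D ⊆ B̄(0, R₀)`, and a far exterior point
  obtain ⟨R₀, hR₀⟩ := D.isBounded.closure.subset_closedBall 0
  obtain ⟨zfar, hzfarE, hzfar⟩ : ∃ z ∈ (closure D.carrier)ᶜ, R₀ < dist z 0 := by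
    by_contra! h
    exact hEb ((isBounded_iff_subset_closedBall 0).2 ⟨R₀, fun z hz => mem_closedBall.2 (h z hz)⟩)
  ---------------------------------------------------------------------------------------------
  -- the loops `J_β` for paths `β` on `∂D` from `q₃` to `q₁`
  ---------------------------------------------------------------------------------------------
  have key : ∀ β : Path (τ (n₁ + k₃)).tip (τ n₁).tip, (∀ s, β s ∈ frontier D.carrier) →
      (wind (fun s => (κ.trans (τ₃.trans (β.trans τ₁.symm))).extend s - ℓ) -
          wind (fun s => (κ.trans (τ₃.trans (β.trans τ₁.symm))).extend s - r) = 1) ∧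
      ((τ (n₁ + k₂)).tip ∉ range β → wind (fun s => (κ.trans (τ₃.trans (β.trans τ₁.symm))).extend s - r) = 0) ∧
      ((∀ z ∈ ball x ρ, z ∉ range β) → wind (fun s => (κ.trans (τ₃.trans (β.trans τ₁.symm))).extend s - ℓ) = 0) ∧
      ((κ.trans (τ₃.trans (β.trans τ₁.symm))).argInc r = κ.argInc r + (τ₃.argInc r + (β.argInc r + τ₁.symm.argInc r))) ∧
      r ∉ range (κ.trans (τ₃.trans (β.trans τ₁.symm))) := by
    intro β hβ
    set J := κ.trans (τ₃.trans (β.trans τ₁.symm)) with hJ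
    have hJrange : range J = range κ ∪ (range τ₃ ∪ (range β ∪ range τ₁)) := by
      rw [hJ, Path.trans_range, Path.trans_range, Path.trans_range, Path.symm_range]
    have hβ_off : ∀ z ∈ D.carrier, z ∉ range β := by
      rintro z hz ⟨s, rfl⟩
      exact hnotU_of_frontier _ (hβ s) hz
    have hJ_off : ∀ z, z ∉ range κ → z ∉ range τ₃ → z ∉ range β → z ∉ range τ₁ → z ∉ range J := by
      intro z h1 h2 h3 h4
      rw [hJrange]
      simp only [mem_union, not_or]
      exact ⟨h1, h2, h3, h4⟩
    have hJcl : range J ⊆ closure D.carrier := by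
      rw [hJrange]
      refine union_subset (hκU'.trans subset_closure) (union_subset (hτcl _) (union_subset ?_ (hτcl _)))
      rintro z ⟨s, rfl⟩; exact frontier_subset_closure (hβ s)
    have hℓβ := hβ_off ℓ (hℓr_U hℓ_seg)
    have hrβ := hβ_off r (hℓr_U hr_seg)
    have hℓJ : ℓ ∉ range J := hJ_off ℓ hℓκ hℓ3 hℓβ hℓ1
    have hrJ : r ∉ range J := hJ_off r hrκ hr3 hrβ hr1
    -- (1) the loop crosses `[ℓ, r]` once
    have hcross : J.crossInc ℓ r = 2 * Real.pi * I := by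
      have hτ₃0 : τ₃.crossInc ℓ r = 0 := Path.crossInc_eq_zero _ fun s hs => (hoffτ_of_seg _ hs).1 ⟨s, rfl⟩
      have hβ0 : β.crossInc ℓ r = 0 := Path.crossInc_eq_zero _ fun s hs => hβ_off _ (hℓr_U hs) ⟨s, rfl⟩
      have hτ₁0 : τ₁.symm.crossInc ℓ r = 0 :=
        Path.crossInc_eq_zero _ fun s hs => (hoffτ_of_seg _ hs).2 ⟨unitInterval.symm s, rfl⟩
      have hκ1 : κ.crossInc ℓ r = 2 * Real.pi * I := by
        rw [hκc, crossInc_tailPoly δ (tileUnion S₀) b (fun h => hℓ_step n₁ (by rw [h]; exact left_mem_segment _ _ _))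
          (fun h => hr_step n₁ (by rw [h]; exact left_mem_segment _ _ _)) (fun i _ => hℓ_step (n₁ + i)) (fun i _ => hr_step (n₁ + i)),
          Finset.sum_eq_single i₀]
        · have e1 : tailPt δ (tileUnion S₀) b (n₁ + i₀) = triMeshPoint δ (faceVertex Fe (j₂ + 1)) := by rw [hfv1, ← ht_i₀]; rfl
          have e2 : tailPt δ (tileUnion S₀) b (n₁ + i₀ + 1) = triMeshPoint δ (faceVertex Fe (j₂ + 2)) := by rw [hfv2, ← ht_i₀']; rfl
          rw [e1, e2]
          exact crossInc_segment_side_mesh hδ Fe j₂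
        · intro i hi hne
          refine Path.crossInc_eq_zero _ fun s hs => ?_
          have hz1 : (Path.segment (tailPt δ (tileUnion S₀) b (n₁ + i)) (tailPt δ (tileUnion S₀) b (n₁ + i + 1))) s ∈
              segment ℝ (triMeshPoint δ (bdryTail (tileUnion S₀) b (n₁ + i))) (triMeshPoint δ (bdryTail (tileUnion S₀) b (n₁ + i + 1))) := by
            rw [← Path.range_segment]; exact mem_range_self s
          have hab := (bdryTail_succ_eq_or_adj hD (n₁ + i)).imp Eq.symm id
          have key : bdryTail (tileUnion S₀) b (n₁ + i) ≠ bdryTail (tileUnion S₀) b (n₁ + i + 1) ∧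
              s(bdryTail (tileUnion S₀) b (n₁ + i), bdryTail (tileUnion S₀) b (n₁ + i + 1)) =
                s(bdryTail (tileUnion S₀) b (n₁ + i₀), bdryTail (tileUnion S₀) b (n₁ + i₀ + 1)) := by
            rw [ht_i₀, ht_i₀']
            rcases eq_side_of_mem_segment_mesh hδ0 hab hz1 hs with ⟨h1, h2⟩ | ⟨h1, h2⟩ <;> rw [hfv1] at * <;> rw [hfv2] at * <;>
              rw [h1, h2]
            · exact ⟨hg₂ne, rfl⟩
            · exact ⟨hg₂ne.symm, Sym2.eq_swap⟩
          have hne₀ : bdryTail (tileUnion S₀) b (n₁ + i₀) ≠ bdryTail (tileUnion S₀) b (n₁ + i₀ + 1) := by rw [ht_i₀, ht_i₀']; exact hg₂ne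
          have hmod := tailStep_pair_eq hD hrem key.1 hne₀ key.2
          have hmod' : i % N = i₀ % N := Nat.ModEq.add_left_cancel' n₁ hmod
          have hik : i < k₃ := Finset.mem_range.1 hi
          rw [Nat.mod_eq_of_lt (by omega), Nat.mod_eq_of_lt (by omega)] at hmod'
          exact hne hmod'
        · intro h; exact absurd (Finset.mem_range.2 hi₀) h
      have hℓrest : ℓ ∉ range (τ₃.trans (β.trans τ₁.symm)) := by
        rw [Path.trans_range, Path.trans_range, Path.symm_range]; simp [hℓ3, hℓβ, hℓ1]
      have hrrest : r ∉ range (τ₃.trans (β.trans τ₁.symm)) := by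
        rw [Path.trans_range, Path.trans_range, Path.symm_range]; simp [hr3, hrβ, hr1]
      have hℓrest' : ℓ ∉ range (β.trans τ₁.symm) := by rw [Path.trans_range, Path.symm_range]; simp [hℓβ, hℓ1]
      have hrrest' : r ∉ range (β.trans τ₁.symm) := by rw [Path.trans_range, Path.symm_range]; simp [hrβ, hr1]
      have hℓ1' : ℓ ∉ range τ₁.symm := by rw [Path.symm_range]; exact hℓ1
      have hr1' : r ∉ range τ₁.symm := by rw [Path.symm_range]; exact hr1
      rw [hJ, Path.crossInc_trans _ _ hℓκ hℓrest hrκ hrrest, Path.crossInc_trans _ _ hℓ3 hℓrest' hr3 hrrest',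
        Path.crossInc_trans _ _ hℓβ hℓ1' hrβ hr1', hκ1, hτ₃0, hβ0, hτ₁0]
      ring
    have hdiff : wind (fun s => J.extend s - ℓ) - wind (fun s => J.extend s - r) = 1 := by
      have h := Path.crossInc_loop J hℓJ hrJ
      rw [hcross] at h
      have h' : ((wind (fun s => J.extend s - ℓ) - wind (fun s => J.extend s - r) : ℤ) : ℂ) = 1 := by
        have := mul_right_cancel₀ two_pi_I_ne_zero (h.symm.trans (one_mul _).symm)
        exact_mod_cast this
      exact_mod_cast h'
    -- transport of the winding number along connected sets off `J`
    set S := (range J)ᶜ with hS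
    have hwind : ∀ {p q : ℂ}, q ∈ connectedComponentIn S p → wind (fun s => J.extend s - p) = wind (fun s => J.extend s - q) :=
      fun {p q} hq => wind_sub_eq_of_mem_connectedComponentIn (K := range J) J.continuous_extend.continuousOn
        (by rw [J.extend_zero, J.extend_one]) (isCompact_range J.continuous).isClosed
        (fun s hs => by rw [Path.extend_apply _ hs]; exact mem_range_self _) hq
    have join : ∀ {w p q : ℂ} {C : Set ℂ}, IsPreconnected C → C ⊆ S → p ∈ C → q ∈ C →
        p ∈ connectedComponentIn S w → q ∈ connectedComponentIn S w := by
      intro w p q C hC hCS hp hq hpw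
      rw [connectedComponentIn_eq hpw]; exact hC.subset_connectedComponentIn hp hCS hq
    -- the exterior `E` of `D` lies off `J`, and `wind = 0` far away
    have hES : (closure D.carrier)ᶜ ⊆ S := fun z hz hzJ => hz (hJcl hzJ)
    have hwfar : wind (fun s => J.extend s - zfar) = 0 :=
      wind_sub_eq_zero_of_dist_le (x := 0) (r := R₀) J.continuous_extend.continuousOn (by rw [J.extend_zero, J.extend_one])
        (fun s hs => by rw [Path.extend_apply _ hs]; exact mem_closedBall.1 (hR₀ (hJcl (mem_range_self _)))) hzfar
    -- from a point of `∂D` off `J`, inside a ball off `J`, to the far exterior point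
    have escape : ∀ {w q : ℂ}, q ∈ frontier D.carrier → q ∉ range J → q ∈ connectedComponentIn S w →
        zfar ∈ connectedComponentIn S w := by
      intro w q hqfr hqJ hqw
      obtain ⟨ε, hε, hball⟩ := Metric.isOpen_iff.1 (isCompact_range J.continuous).isClosed.isOpen_compl q hqJ
      obtain ⟨e, heE, hed⟩ : ∃ e ∈ (closure D.carrier)ᶜ, dist q e < ε :=
        Metric.mem_closure_iff.1 (D.frontier_subset_closure_exterior hJCT hqfr) ε hε
      have hseg : segment ℝ q e ⊆ S := fun z hz =>
        hball ((convex_ball q ε).segment_subset (mem_ball_self hε) (mem_ball.2 (by rw [dist_comm]; exact hed)) hz)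
      have he : e ∈ connectedComponentIn S w :=
        join (convex_segment _ _).isPreconnected hseg (left_mem_segment _ _ _) (right_mem_segment _ _ _) hqw
      exact join hEc.isPreconnected hES heE hzfarE he
    -- (2) if `q₂ ∉ β`: `r` is joined off `J` to `q₂`, then to the far exterior point
    have hpart2 : (τ (n₁ + k₂)).tip ∉ range β → wind (fun s => J.extend s - r) = 0 := by
      intro hq₂β
      -- fans at `u₂`
      have hfan : ∀ s : Fin 6, s.val < m₂.val →
          segment ℝ (meshCenter δ (leftFaceDir (bdryTail (tileUnion S₀) b (n₁ + k₂)) (a₂ + s)))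
            (meshCenter δ (leftFaceDir (bdryTail (tileUnion S₀) b (n₁ + k₂)) (a₂ + s + 5))) ⊆ S := by
        intro s hs z hz
        have hout : bdryTail (tileUnion S₀) b (n₁ + k₂) + triDir (a₂ + s) ∉ tileUnion S₀ := (hR₂.out_iff s).2 hs
        have hnear := dist_le_of_mem_fanSeg hδ _ (a₂ + s) hz
        have hoff := near_off z (by linarith)
        exact hJ_off z (hκ_off z fun n hz1 => tailStep_not_mem_fanSeg hD hδ0 hout n hz1 hz) hoff.1
          (hβ_off z (hGU _ hu₂G (mem_closedBall.2 (by linarith)))) hoff.2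
      have hfanConn : ∀ s s' : ℕ, s ≤ s' → s' < m₂.val →
          (meshCenter δ (leftFaceDir (bdryTail (tileUnion S₀) b (n₁ + k₂)) (a₂ + Fin.ofNat 6 s)) ∈ connectedComponentIn S r ↔
            meshCenter δ (leftFaceDir (bdryTail (tileUnion S₀) b (n₁ + k₂)) (a₂ + Fin.ofNat 6 s')) ∈ connectedComponentIn S r) := by
        intro s s' hss' hs'
        induction s', hss' using Nat.le_induction with
        | base => exact Iff.rfl
        | succ s' hss' ih =>
          rw [ih (by omega)]
          have hval : (Fin.ofNat 6 (s' + 1)).val < m₂.val := by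
            rw [Fin.val_ofNat, Nat.mod_eq_of_lt (by have := hR₂.le_five; omega)]; exact hs'
          have hseg := hfan (Fin.ofNat 6 (s' + 1)) hval
          rw [add_ofNat_succ_add_five] at hseg
          exact ⟨fun h => join (convex_segment _ _).isPreconnected hseg (right_mem_segment _ _ _) (left_mem_segment _ _ _) h,
            fun h => join (convex_segment _ _).isPreconnected hseg (left_mem_segment _ _ _) (right_mem_segment _ _ _) h⟩
      -- from `r` around `u₂` to the face on the dart edge, then to its midpoint
      obtain ⟨κ₂, hw₂, hw₂G⟩ := hhead (n₁ + k₂)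
      obtain ⟨t₂, rfl⟩ := exists_offset a₂ κ₂
      have ht₂ : t₂.val < m₂.val := (hR₂.out_iff t₂).1 hw₂G
      have hrS : r ∈ connectedComponentIn S r := mem_connectedComponentIn hrJ
      have stepA : meshCenter δ (leftFaceDir (bdryTail (tileUnion S₀) b (n₁ + k₂)) (a₂ + t₂)) ∈ connectedComponentIn S r := by
        have h0 : meshCenter δ (leftFaceDir (bdryTail (tileUnion S₀) b (n₁ + k₂)) (a₂ + Fin.ofNat 6 (m₂.val - 1))) ∈ connectedComponentIn S r := by
          rw [← add_add_five_eq a₂ m₂ hR₂.one_le, ← hFopp]; exact hrS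
        have := (hfanConn t₂.val (m₂.val - 1) (by omega) (by omega)).2 h0
        rwa [fin6_ofNat_val] at this
      have stepB : (τ (n₁ + k₂)).path (τ (n₁ + k₂)).anchor ∈ connectedComponentIn S r := by
        rw [(τ (n₁ + k₂)).anchor_eq, hw₂]
        exact join (convex_segment _ _).isPreconnected (hfan t₂ ht₂) (left_mem_segment _ _ _) (midpoint_mem_fanSeg δ _ (a₂ + t₂)) stepA
      -- along the tether to the tip
      have stepC : (τ (n₁ + k₂)).tip ∈ connectedComponentIn S r := by
        set T := τ (n₁ + k₂) with hT
        have hC : IsPreconnected ((fun y : ℝ => T.path.extend y) '' Icc (T.anchor : ℝ) 1) :=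
          isPreconnected_Icc.image _ T.path.continuous_extend.continuousOn
        have hCS : (fun y : ℝ => T.path.extend y) '' Icc (T.anchor : ℝ) 1 ⊆ S := by
          rintro z ⟨y, hy, rfl⟩
          have hy01 : y ∈ Icc (0 : ℝ) 1 := ⟨T.anchor.2.1.trans hy.1, hy.2⟩
          show T.path.extend y ∈ S
          rw [Path.extend_apply _ hy01]
          set s : unitInterval := ⟨y, hy01⟩
          have hle : T.anchor ≤ s := hy.1
          have hoff := near_off (T.path s) (T.dist_le s)
          refine hJ_off _ (hκ_off _ fun n' => (T.avoids s hle).not_mem_tailStep hD n') hoff.1 ?_ hoff.2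
          rcases eq_or_lt_of_le hy.2 with hy1 | hy1
          · have : T.path s = T.tip := by rw [show s = 1 from Subtype.ext hy1]; exact T.path.target
            rw [this]; exact hq₂β
          · exact hβ_off _ (T.mem_of_lt_one s hy1)
        exact join hC hCS ⟨T.anchor, ⟨le_rfl, T.anchor.2.2⟩, Path.extend_extends' _ _⟩ ⟨1, ⟨T.anchor.2.2, le_rfl⟩, Path.extend_one _⟩ stepB
      -- the tip is off `J`; escape to the exterior
      have hq₂J : (τ (n₁ + k₂)).tip ∉ range J := by
        refine hJ_off _ (fun h => hnotU_of_frontier _ (τ (n₁ + k₂)).tip_mem (hκU' h)) ?_ hq₂β ?_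
        · rintro ⟨s, hs⟩
          rcases eq_or_lt_of_le s.2.2 with hs1 | hs1
          · have : τ₃ s = (τ (n₁ + k₃)).tip := by rw [show s = 1 from Subtype.ext hs1]; exact (τ (n₁ + k₃)).path.target
            exact hq23 (hs.symm.trans this)
          · exact hnotU_of_frontier _ (τ (n₁ + k₂)).tip_mem (hs ▸ (τ (n₁ + k₃)).mem_of_lt_one s hs1)
        · rintro ⟨s, hs⟩
          rcases eq_or_lt_of_le s.2.2 with hs1 | hs1
          · have : τ₁ s = (τ n₁).tip := by rw [show s = 1 from Subtype.ext hs1]; exact (τ n₁).path.target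
            exact hq21 (hs.symm.trans this)
          · exact hnotU_of_frontier _ (τ (n₁ + k₂)).tip_mem (hs ▸ (τ n₁).mem_of_lt_one s hs1)
      rw [hwind (escape (τ (n₁ + k₂)).tip_mem hq₂J stepC), hwfar]
    -- (3) if the far ball misses `β`: `ℓ` is joined off `J` through the faces of `G` to the ball, then out
    have hpart3 : (∀ z ∈ ball x ρ, z ∉ range β) → wind (fun s => J.extend s - ℓ) = 0 := by
      intro hxβ
      have hballS : ball x ρ ⊆ S := fun z hz =>
        hJ_off z (hκ_off' z (fun h => by have := hx1 z hz; rw [h, dist_self] at this; linarith) (hxκ z hz))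
          (hτ_off _ z (hx3 z hz)) (hxβ z hz) (hτ_off _ z (hx1 z hz))
      have hGseg : ∀ (F : HexVertex) (j : Fin 3), hexFaceVertices F ⊆ tileUnion S₀ → hexFaceVertices (oppFace F j) ⊆ tileUnion S₀ →
          segment ℝ (meshCenter δ F) (meshCenter δ (oppFace F j)) ⊆ S := by
        intro F j hF hF' z hz
        have hzU : z ∈ D.carrier := hGU _ (hF (faceVertex_mem F (j + 1)))
          (mem_closedBall.2 (by linarith [dist_le_of_mem_centreSeg hδ hz (faceVertex_mem F (j + 1)) (faceVertex_succ_mem_oppFace F j)]))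
        have hτgen : ∀ n, z ∉ range (τ n).path := by
          rintro n ⟨s, hs⟩
          rw [← hs] at hz
          rcases le_total (τ n).anchor s with hle | hle
          · exact ((τ n).avoids s hle).2 F j hF hF' hz
          · have hmem := (τ n).before_anchor s hle
            obtain ⟨-, hw, hadj⟩ := mem_triBdryDarts.1 (triBdryIter_mem hD.base_mem n)
            rcases eq_side_of_mem_segment_mesh hδ0 (Or.inr hadj) hmem hz with ⟨-, h2⟩ | ⟨-, h2⟩
            · exact hw (hF (h2 ▸ faceVertex_mem F _))
            · exact hw (hF (h2 ▸ faceVertex_mem F _))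
        exact hJ_off z (hκ_off z fun n hz1 => not_mem_centreSeg_of_mem_tailStep hD hδ0 hF hF' n hz1 hz) (hτgen _) (hβ_off z hzU) (hτgen _)
      obtain ⟨F₀, hF₀, hF₀x⟩ := hxF
      have hℓS : ℓ ∈ connectedComponentIn S ℓ := mem_connectedComponentIn hℓJ
      have step1 : meshCenter δ F₀ ∈ connectedComponentIn S ℓ :=
        meshCenter_mem_connectedComponentIn_of_pathIn hGseg hℓJ
          (pathIn_triFacesIn_tileUnion hconn (mem_triFacesIn.2 hFeG) (mem_triFacesIn.2 hF₀))
      have step2 : x ∈ connectedComponentIn S ℓ :=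
        join (convex_segment _ _).isPreconnected
          (fun z hz => hballS ((convex_ball x ρ).segment_subset (mem_ball.2 hF₀x) (mem_ball_self hρ) hz))
          (left_mem_segment _ _ _) (right_mem_segment _ _ _) step1
      have hxJ : x ∉ range J := hballS (mem_ball_self hρ)
      rw [hwind (escape hx hxJ step2), hwfar]
    -- (4) the argument increments add up
    have hrrest : r ∉ range (τ₃.trans (β.trans τ₁.symm)) := by
      rw [Path.trans_range, Path.trans_range, Path.symm_range]; simp [hr3, hrβ, hr1]
    have hrrest' : r ∉ range (β.trans τ₁.symm) := by rw [Path.trans_range, Path.symm_range]; simp [hrβ, hr1]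
    have hr1' : r ∉ range τ₁.symm := by rw [Path.symm_range]; exact hr1
    have hpart4 : J.argInc r = κ.argInc r + (τ₃.argInc r + (β.argInc r + τ₁.symm.argInc r)) := by
      rw [hJ, Path.argInc_trans _ _ hrκ hrrest, Path.argInc_trans _ _ hr3 hrrest', Path.argInc_trans _ _ hrβ hr1']
    exact ⟨hdiff, hpart2, hpart3, hpart4, hrJ⟩
  ---------------------------------------------------------------------------------------------
  -- the direct arc `α` and the complementary arc `α'`
  ---------------------------------------------------------------------------------------------
  let αp : Path (τ (n₁ + k₃)).tip (τ n₁).tip :=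
    { toFun := fun s => D.boundary (σ₃ + (s : ℝ) * (σ₁ - σ₃))
      continuous_toFun := D.continuous_boundary.comp (by fun_prop)
      source' := by simp [hq₃]
      target' := by simp [hq₁] }
  have hαap : ∀ s, αp s = D.boundary (σ₃ + (s : ℝ) * (σ₁ - σ₃)) := fun s => rfl
  have hα_fr : ∀ s, αp s ∈ frontier D.carrier := fun s => D.boundary_mem_frontier _
  have hα_range : ∀ s : unitInterval, σ₃ + (s : ℝ) * (σ₁ - σ₃) ∈ Icc (min σ₁ σ₃) (max σ₁ σ₃) := fun s => by
    rcases le_total σ₁ σ₃ with h | h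
    · rw [min_eq_left h, max_eq_right h]
      constructor <;> nlinarith [s.2.1, s.2.2]
    · rw [min_eq_right h, max_eq_left h]
      constructor <;> nlinarith [s.2.1, s.2.2]
  obtain ⟨hA1, hA2, hA3, hA4, hrJα⟩ := key αp hα_fr
  have wℓ : wind (fun s => (κ.trans (τ₃.trans (αp.trans τ₁.symm))).extend s - ℓ) = 0 :=
    hA3 fun z hz ⟨s, hs⟩ => hxα z hz ⟨_, hα_range s, (hαap s).symm.trans hs⟩
  have wr : wind (fun s => (κ.trans (τ₃.trans (αp.trans τ₁.symm))).extend s - r) = -1 := by omega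
  have hq₂α : (τ (n₁ + k₂)).tip ∈ range αp := by
    by_contra h
    have := hA2 h
    omega
  -- the complementary arc
  set mI : ℤ := if σ₁ ≤ σ₃ then -1 else 1 with hmI
  set σ₁' : ℝ := σ₁ - mI with hσ₁'
  have hbσ₁' : D.boundary σ₁' = D.boundary σ₁ := by
    have := (D.periodic_boundary.int_mul (-mI)) σ₁
    rw [mul_one] at this
    rw [hσ₁', sub_eq_add_neg, ← Int.cast_neg, this]
  let α'p : Path (τ (n₁ + k₃)).tip (τ n₁).tip :=
    { toFun := fun s => D.boundary (σ₃ + (s : ℝ) * (σ₁' - σ₃))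
      continuous_toFun := D.continuous_boundary.comp (by fun_prop)
      source' := by simp [hq₃]
      target' := by simp [hbσ₁', hq₁] }
  have hα'ap : ∀ s, α'p s = D.boundary (σ₃ + (s : ℝ) * (σ₁' - σ₃)) := fun s => rfl
  have hα'_fr : ∀ s, α'p s ∈ frontier D.carrier := fun s => D.boundary_mem_frontier _
  -- `q₂ ∈ α` is off `α'`
  have hq₂α' : (τ (n₁ + k₂)).tip ∉ range α'p := by
    rintro ⟨s', hs'⟩
    obtain ⟨s, hs⟩ := hq₂α
    have e : D.boundary (σ₃ + (s' : ℝ) * (σ₁' - σ₃)) = D.boundary (σ₃ + (s : ℝ) * (σ₁ - σ₃)) := by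
      rw [← hα'ap, ← hαap, hs, hs']
    obtain ⟨n, hn⟩ := D.exists_int_of_boundary_eq e
    rcases eq_endpoint_of_mem_both h13 s.2.1 s.2.2 s'.2.1 s'.2.2 hn with h | h
    · exact hq23 (hs.symm.trans (by rw [hαap, h, hq₃]))
    · exact hq21 (hs.symm.trans (by rw [hαap, h, hq₁]))
  obtain ⟨-, hB2, -, hB4, hrJα'⟩ := key α'p hα'_fr
  have wr' : wind (fun s => (κ.trans (τ₃.trans (α'p.trans τ₁.symm))).extend s - r) = 0 := hB2 hq₂α'
  ---------------------------------------------------------------------------------------------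
  -- the difference of the two loops is the boundary traversed once, in the direction of `α`
  ---------------------------------------------------------------------------------------------
  have hrα : r ∉ range αp := by rintro ⟨s, hs⟩; exact hr_fr (hs ▸ hα_fr s)
  have hrα' : r ∉ range α'p := by rintro ⟨s, hs⟩; exact hr_fr (hs ▸ hα'_fr s)
  have hrα's : r ∉ range α'p.symm := by rw [Path.symm_range]; exact hrα'
  -- the loop `α · α'⁻¹` is `t ↦ ∂D(φ t)` with `φ 1 = φ 0 + mI`
  set φ : ℝ → ℝ := fun t => if t ≤ 1 / 2 then σ₃ + (2 * t) * (σ₁ - σ₃) else σ₃ + (2 - 2 * t) * (σ₁' - σ₃) + mI with hφ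
  have hφc : Continuous φ := by
    refine Continuous.if_le (by fun_prop) (by fun_prop) continuous_id continuous_const fun t ht => ?_
    rw [ht, hσ₁']; ring
  have hφ01 : φ 1 = φ 0 + mI := by
    simp only [hφ]
    rw [if_neg (by norm_num), if_pos (by norm_num)]
    ring
  have hloop : wind (fun t => (αp.trans α'p.symm).extend t - r) = mI := by
    have e : wind (fun t => (αp.trans α'p.symm).extend t - r) = wind (fun t => D.boundary (φ t) - r) := by
      refine wind_congr fun t ht => ?_
      show (αp.trans α'p.symm).extend t - r = D.boundary (φ t) - r
      rw [Path.extend_apply _ ht, Path.trans_apply]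
      congr 1
      split_ifs with h
      · have h' : t ≤ 1 / 2 := h
        show D.boundary (σ₃ + (2 * t) * (σ₁ - σ₃)) = D.boundary (φ t)
        rw [hφ]
        simp only [if_pos h']
      · have h' : ¬ t ≤ 1 / 2 := h
        show D.boundary (σ₃ + (1 - (2 * t - 1)) * (σ₁' - σ₃)) = D.boundary (φ t)
        rw [hφ]
        simp only [if_neg h']
        have := (D.periodic_boundary.int_mul mI) (σ₃ + (2 - 2 * t) * (σ₁' - σ₃))
        rw [mul_one] at this
        rw [this]
        congr 1; ring
    rw [e, D.wind_boundary_comp_eq_mul_index hφc.continuousOn hφ01 hr_fr, hind r hrU, mul_one]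
  have hdiffα : ((-1 : ℤ) : ℂ) * (2 * Real.pi * I) - (0 : ℤ) * (2 * Real.pi * I) = (mI : ℂ) * (2 * Real.pi * I) := by
    rw [← wr, ← wr', ← Path.argInc_eq_wind_mul _ hrJα, ← Path.argInc_eq_wind_mul _ hrJα', hA4, hB4, ← hloop,
      ← Path.argInc_eq_wind_mul _ (by rw [Path.trans_range, Path.symm_range]; simp [hrα, hrα']),
      Path.argInc_trans _ _ hrα hrα's, Path.argInc_symm _ hrα']
    ring
  have hmI1 : mI = -1 := by
    have : ((-1 : ℤ) : ℂ) * (2 * Real.pi * I) = (mI : ℂ) * (2 * Real.pi * I) := by rw [← hdiffα]; push_cast; ring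
    exact (int_eq_of_mul_two_pi_I_eq this).symm
  -- conclusion
  have hle : σ₁ ≤ σ₃ := by
    by_contra h
    rw [hmI, if_neg h] at hmI1
    norm_num at hmI1
  rcases hle.eq_or_lt with heq | hlt
  · exfalso
    obtain ⟨s, hs⟩ := hq₂α
    rw [hαap, heq, sub_self, mul_zero, add_zero] at hs
    exact hq23 (hs.symm.trans hq₃)
  · exact hlt

end Literature.Probability.Percolation
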